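import Summits.BirchSwinnertonDyer.BirchSwinnertonDyer.Theorems.GoldfeldAllTwistsTwoConverseTwinBirchLocal
import Summits.BirchSwinnertonDyer.Rank1Residual.P2.CMRankOneAtTwoHeegnerIndex
import Literature.NumberTheory.EllipticCurves.Curve49A1Points
import Literature.NumberTheory.EllipticCurves.GlobalMinimalModel
import HarnessLib

set_option linter.dupNamespace false -- `…BirchSwinnertonDyer.BirchSwinnertonDyer…` is the cell's namespace (D-0017)
set_option autoImplicit false

/-!
# LINE B49 — THEOREM B, fixed-curve factors (B1d): `#X₀(49)(ℚ) = 2`, `Tam(X₀(49)) = 2`,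
# `ord₂ twinQuotient(X₀(49)) = −1`, and `|u| = 1` for every minimal model of `49a1^{(−q)}`

Cell `bsd-goldfeld`, seat `bsd-goldfeld-s1p-c301` (prover, gen 8); planner ruling g19 (liii), scope memo
`HOME/GENUS-THEOREM-B.md` factors F7 (`tq = twinQuotient cm7 = #Ш·∏c/#E(ℚ)²`) and F8 (`|u| = 1`). Support for item
`stmt-BirchSwinnertonDyer-19140` (twin″); Theses-free; theorems only. HONEST FRAMING: arithmetic of the fixed curve
`X₀(49)` and a minimality bookkeeping; the ONE printed input is Coates–Li–Tian–Zhai 2015 Thm 1.2 at `R = 1`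
(`Ш(X₀(49))` finite of odd order), a binder `h12` already carried by the whole line; BSD is not proved by any of this.

WHAT IS PROVED.
* §1 `#X₀(49)(ℚ) = 2` from the tree's COMPLETE determination of the rational points (`Curve49A1.points`: every
  affine point is `(2, −1)`); `Tam(X₀(49)) = c₇ = 2` (file B1a's type-`III` certificate, good reduction off `7`).
* §2 `twinQuotient cm7 = #Ш(X₀(49))·2/4` and **`ord₂ twinQuotient(X₀(49)) = −1`** granted `h12` (`#Ш` odd).
* §3 **`|Cd.u| = 1`** for every GLOBALLY MINIMAL `W` with `Cd • X₀(49)^{(−4q)} = W` (`X₀(49)^{(−4q)} = [0,3q,0,−32q²,64q³]`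
  is itself globally minimal, file B1a; two global minimal models differ by `u = ±1`, tree `isGloballyMinimal_unique_holds`).
References: [CremonaAlgorithms1997] Table 1 (N = 49: `r = 0`, `|T| = 2`, `c₇ = 2`); [CoatesLiTianZhai2015] Thm 1.2;
[SilvermanAEC2009] VII.1.3(b), VIII.8.3.
-/

noncomputable section

open scoped Classical NumberField

open WeierstrassCurve IsDedekindDomain Rat.HeightOneSpectrum
  Literature.NumberTheory.EllipticCurves Literature.NumberTheory.EllipticCurves.ModularForms
  Summit.BirchSwinnertonDyer.BirchSwinnertonDyer.Rank2Observatory.RootNumber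
  Summit.BirchSwinnertonDyer.Rank1Residual.P2

namespace Summit.BirchSwinnertonDyer.BirchSwinnertonDyer.Theorems.GoldfeldGoodTwists

/-! ## §1 `#X₀(49)(ℚ) = 2` and `Tam(X₀(49)) = 2` -/

/-- `(2, −1) ∈ X₀(49)(ℚ)` (the rational `2`-torsion point). [cite: CremonaAlgorithms1997, Table 1 (N = 49)] -/
theorem nonsingular_cm7_two_neg_one : cm7.toAffine.Nonsingular 2 (-1) := by
  refine (Affine.equation_iff_nonsingular).mp ?_
  rw [Affine.equation_iff']
  norm_num

/-- **`#X₀(49)(ℚ) = 2`**: `X₀(49)(ℚ) = {O, (2, −1)}` (tree `Curve49A1.points`, a complete `2`-isogeny descent plus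
torsion). [cite: CremonaAlgorithms1997, Table 1 (N = 49: r = 0, |T| = 2)] -/
theorem natCard_point_cm7 : Nat.card cm7.toAffine.Point = 2 := by
  rw [Nat.card_eq_two_iff' (0 : cm7.toAffine.Point)]
  refine ⟨.some 2 (-1) nonsingular_cm7_two_neg_one, fun h0 => Affine.Point.some_ne_zero _ h0, fun P hP => ?_⟩
  rcases P with _ | ⟨x, y, hxy⟩
  · exact absurd rfl hP
  · have he : y ^ 2 + x * y = x ^ 3 - x ^ 2 - 2 * x - 1 := by
      have h := hxy.1
      rw [Affine.equation_iff'] at h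
      norm_num at h
      linear_combination h
    obtain ⟨rfl, rfl⟩ := Curve49A1.points x y he
    rfl

/-- A prime dividing `Δ(49a1) = −343` is `7`. [folklore] -/
theorem eq_seven_of_dvd_int49a1_Δ {p : ℕ} (hp : p.Prime)
    (h : (p : ℤ) ∣ (⟨1, -1, 0, -2, -1⟩ : WeierstrassCurve ℤ).Δ) : p = 7 := by
  rw [int49a1_Δ, show (-343 : ℤ) = -(7 ^ 3) by norm_num, dvd_neg] at h
  have h' : p ∣ 7 ^ 3 := by exact_mod_cast h
  exact (Nat.prime_dvd_prime_iff_eq hp (by norm_num)).mp (hp.dvd_of_dvd_pow h')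

/-- **`Tam(X₀(49)) = c₇ = 2`** (type `III` at `7`, file B1a; good reduction off `7`).
[cite: CremonaAlgorithms1997, Table 1 (N = 49)] [cite: Silverman1994, IV.9.4 Step 4] -/
theorem tamagawaProduct_cm7 : cm7.tamagawaProduct = 2 := by
  haveI : Fact (Nat.Prime 7) := ⟨by norm_num⟩
  set v₇ : HeightOneSpectrum ℤ := (primesEquiv (R := ℤ)).symm ⟨7, by norm_num⟩ with hv₇
  have h7 : (primesEquiv v₇ : ℕ) = 7 := by rw [hv₇, Equiv.apply_symm_apply]
  have hprod := tamagawaProduct_eq_prod cm7 {v₇} (by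
    intro v hv
    by_contra hmem
    apply hv
    rw [cm7_eq_baseChange_int49a1]
    refine hasGoodReductionAt_of_not_dvd fun hdvd => hmem ?_
    have h := eq_seven_of_dvd_int49a1_Δ (prime_natGenerator v) hdvd
    have : v = v₇ := by
      apply (primesEquiv (R := ℤ)).injective
      exact Subtype.ext (by rw [h7]; exact h)
    simp [this])
  rw [Finset.prod_singleton] at hprod
  rw [hprod]
  exact localTamagawaNumber_padic_eq_of_forall_place cm7 v₇ 7 h7 2 (fun w hw => localTamagawaNumber_cm7_seven w hw)

/-! ## §2 `twinQuotient(X₀(49))`: `ord₂ = −1` -/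

/-- `#Ш(X₀(49))` is ODD (and `Ш` finite, `L(X₀(49),1) ≠ 0`, rank `0`) — Coates–Li–Tian–Zhai 2015 Thm 1.2 at `R = 1`
(tree `CoatesLiTianZhai2015.bsdTriple_cm7_of_thm12`). [cite: CoatesLiTianZhai2015, Thm. 1.2 (p. 359, case r = 0)] -/
theorem odd_shaOrder_cm7 (h12 : CoatesLiTianZhai2015.thm12_fullBSD_twist) : Odd cm7.shaOrder := by
  have hC : ∃ C : VariableChange ℚ, C • cm7 = cm7.quadraticTwist ((1 : ℕ) : ℚ) := by
    rw [Nat.cast_one]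
    exact cm7.exists_variableChange_quadraticTwist_one
  exact (CoatesLiTianZhai2015.bsdTriple_cm7_of_thm12 h12 hC).2.2.2.1

/-- **`twinQuotient(X₀(49)) = #Ш(X₀(49)) / 2`** (`Tam = 2`, `#X₀(49)(ℚ) = 2`). [cite: CremonaAlgorithms1997, Table 1 (N = 49)] -/
theorem twinQuotient_cm7 : twinQuotient cm7 = (cm7.shaOrder : ℚ) / 2 := by
  unfold twinQuotient
  rw [tamagawaProduct_cm7, natCard_point_cm7]
  push_cast
  ring

/-- **`ord₂ twinQuotient(X₀(49)) = −1`** granted CLTZ Thm 1.2 at `R = 1` (`#Ш` odd): factor `tq` of `𝔮₄₉`.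
[cite: CoatesLiTianZhai2015, Thm. 1.2 (p. 359, case r = 0)] -/
theorem padicValRat_two_twinQuotient_cm7 (h12 : CoatesLiTianZhai2015.thm12_fullBSD_twist) :
    padicValRat 2 (twinQuotient cm7) = -1 := by
  have hodd := odd_shaOrder_cm7 h12
  have hS0 : (cm7.shaOrder : ℚ) ≠ 0 := by exact_mod_cast hodd.pos.ne'
  haveI : Fact (Nat.Prime 2) := ⟨Nat.prime_two⟩
  have h1 : padicValNat 2 cm7.shaOrder = 0 := padicValNat.eq_zero_of_not_dvd (fun h =>
    (Nat.not_even_iff_odd.mpr hodd) (even_iff_two_dvd.mpr h))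
  rw [twinQuotient_cm7, padicValRat.div hS0 two_ne_zero, padicValRat.of_nat, h1,
    show padicValRat 2 (2 : ℚ) = 1 by simpa using padicValRat.self (p := 2) one_lt_two]
  norm_num

/-- `twinQuotient(X₀(49)) ≠ 0` (granted `h12`). [cite: CoatesLiTianZhai2015, Thm. 1.2] -/
theorem twinQuotient_cm7_ne_zero (h12 : CoatesLiTianZhai2015.thm12_fullBSD_twist) : twinQuotient cm7 ≠ 0 := by
  rw [twinQuotient_cm7]
  exact div_ne_zero (by exact_mod_cast (odd_shaOrder_cm7 h12).pos.ne') two_ne_zero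

/-! ## §3 `|u| = 1` for every global minimal model of `49a1^{(−q)}` -/

/-- `X₀(49)^{(−4q)}` is globally minimal for `q ≡ 1 (mod 4)` prime, `q ≠ 7` (file B1a, transported along
`twistModel_baseChange`). [cite: Kraus1989, Prop. 2] -/
theorem isGloballyMinimal_cm7_quadraticTwist_negFourMul {q : ℕ} (hq : q.Prime) (hq4 : q % 4 = 1) (hq7 : q ≠ 7) :
    (cm7.quadraticTwist (((-(4 * q) : ℤ)) : ℚ)).IsGloballyMinimal := by
  rw [← twistModel_baseChange]
  exact isGloballyMinimal_twistModel hq hq4 hq7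

/-- **`|Cd.u| = 1` for every globally minimal `W` with `Cd • X₀(49)^{(−4q)} = W`** (both sides are global minimal
models; tree `isGloballyMinimal_unique_holds`): the factor `|u|` of `𝔮₄₉` is `1`. [cite: SilvermanAEC2009, VII.1.3(b) and VIII.8.3] -/
theorem abs_u_eq_one_of_smul_cm7_quadraticTwist_negFourMul {q : ℕ} (hq : q.Prime) (hq4 : q % 4 = 1)
    (hq7 : q ≠ 7) (W : WeierstrassCurve ℚ) [W.IsGloballyMinimal] (Cd : VariableChange ℚ)
    (hW : Cd • cm7.quadraticTwist (((-(4 * q) : ℤ)) : ℚ) = W) : |(Cd.u : ℚ)| = 1 := by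
  have hd : (((-(4 * q) : ℤ)) : ℚ) ≠ 0 := by
    have := hq.pos; exact_mod_cast (show (-(4 * (q : ℤ))) ≠ 0 by omega)
  haveI := cm7.isElliptic_quadraticTwist hd
  haveI := isGloballyMinimal_cm7_quadraticTwist_negFourMul hq hq4 hq7
  haveI : (Cd • cm7.quadraticTwist (((-(4 * q) : ℤ)) : ℚ)).IsGloballyMinimal := by rw [hW]; infer_instance
  rcases (isGloballyMinimal_unique_holds (cm7.quadraticTwist (((-(4 * q) : ℤ)) : ℚ)) Cd).1 with h | h
  · rw [h]; simp
  · rw [h]; simp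

variable {K : Type} [Field K] [NumberField K]

/-- The same in the coordinates of `X049BirchLemmaEvenDiscr` (`Cd • X₀(49)^{(d_K)} = W`, `d_K = −4q`, `(q/7) = −1`).
[cite: SilvermanAEC2009, VII.1.3(b) and VIII.8.3] -/
theorem abs_u_eq_one_of_smul_cm7_quadraticTwist_discr (hK : IsImaginaryQuadratic K) {q : ℕ} (hq : q.Prime)
    (hq7 : jacobiSym q 7 = -1) (hdK : NumberField.discr K = -(4 * (q : ℤ)))
    (W : WeierstrassCurve ℚ) [W.IsGloballyMinimal] (Cd : VariableChange ℚ)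
    (hW : Cd • cm7.quadraticTwist (NumberField.discr K : ℚ) = W) : |(Cd.u : ℚ)| = 1 := by
  obtain ⟨-, hq7'⟩ := ne_two_and_ne_seven_of_jacobiSym hq7
  rw [hdK] at hW
  exact abs_u_eq_one_of_smul_cm7_quadraticTwist_negFourMul hq (emod_four_of_discr_eq hK hq hq7 hdK) hq7' W Cd
    (by exact_mod_cast hW)

end Summit.BirchSwinnertonDyer.BirchSwinnertonDyer.Theorems.GoldfeldGoodTwists

end
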